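import Summits.QuantumFields.YangMills.Theorems.BalabanLadderIRStubRungStrong
import Literature.MathematicalPhysics.QuantumFieldTheory.YangMillsOS
import Literature.Probability.LatticeModels.LocalPerturbationObservables
import HarnessLib

/-!
# Crux `IR` (stmt-QuantumFields-19354), lane B «strong coupling AFTER BLOCKING»: the blocked-activity currency (definitions)

Definition module for item `stmt-QuantumFields-19354` (`--supports`; it closes nothing), second prover lane
`ym-19354-onsetsc-p2` (owner R92 ∕ R93 (L1): «type the missing currency — interface `BlockedActivityClass` + target
`univShellCond_of_blockedActivity` + a separate construction statement»).  Route-independent: only the tree's kernel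
vocabulary (`Tempered.cellEdges ∕ windowCells ∕ regionEdges`, `ymSpecification`) and the tree's Kotecký–Preiss layer
`Literature.Probability.LatticeModels.LocalPerturbation*` (`IsLocalPerturbation`, `IsLocalObservable`, `pertExpect`).

THE CURRENCY.  «The mesh-`b` blocked effective theory lies in a polymer-activity ball where the high-temperature ∕ cluster
expansion converges» is typed in the INPUT FORMAT of the tree's expansion layer (Friedli–Velenik §5.7.1; Osterwalder–Seiler
1978 §3 for the strong-coupling expansion of lattice gauge theory): a `BlockedRep ρ β w Y a` is a σ-INDEPENDENT reference
probability space `(Ω, μ)` with cell σ-algebras `𝓕 c`, `c ∈ ℤ⁴`, independent across non-touching cell sets (finite range,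
sup-adjacency `CellAdj`), cell factors `g σ c` (`𝓕 c`-measurable, `‖g σ c‖ ≤ a`, reading the exterior datum `σ` only on the
cells adjacent to `c` outside `Y`), a realisation `obs f` of centre observables as cell-`0`-local observables, and the
representation of the kernel expectation `∫ f d(ymSpecification ρ β (regionEdges w Y) σ)` as the perturbed expectation
`pertExpect μ (g σ) (obs f) C`.  Its polymer activities `∫ ∏_{c ∈ K} g σ c dμ` are then `≤ a^{#K}` (tree
`norm_cellActivity_le`) — the activity ball of radius `a`.  `BlockedActivityClass ρ β b n a` asks this on every mesh-`b` frame
for every cell region of the `n`-window containing the centre; `BlockedActivityOnsetAt ρ` asks, for every radius `a > 0`, a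
mesh `b(β) ≥ 1` in the class at window `1` for all large `β`; `BlockedActivityOnsetSC` asks it for every lattice representation
of every SIMPLY CONNECTED compact simple `G` (the monopole wire of `Theorems/IR/Negative/OnsetUcFalseOfMonopoleWire`, p521601,
kills all-exterior onset statements on the `π₁ ≠ 1` family).

The reduction `BlockedActivityClass ⇒ OnsetFormats.UnivShellCond` (volume-uniform Kotecký–Preiss ∕ Dobrushin bound of the tree,
`norm_pertExpect_sub_integral_le'`) and `BlockedActivityOnsetSC ⇒ OnsetFormatsUc.OnsetMixingTypicalUKPcSC` (the registered
stub `stub_onsetUcSC` BY NAME) are in the sibling module `Theorems/IR/BlockedActivityUnivShellCond`.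

presearch: «blocked theory at `b ≍ ξ` in the KP ball» → [corpus: arxiv-0707.2179 p.1] Tomboulis' RG-decimation-into-the-
strong-coupling-region claim for 4-d SU(2) (Migdal–Kadanoff-type decimations + interpolation), disputed and not accepted
[corpus: arxiv-0901.4246 pp.2–6; Ito–Seiler arXiv:0711.4930 ∕ reply 0712.2620]; barrier
`Literature.Barriers.QuantumFields.MigdalKadanoffGroupBlindness` applies to group-blind decimations, and
`Literature.Barriers.QuantumFields.AbelianDeconfinementD4` (Guth 1980) says the class must FAIL for `U(1)` at large `β` —
consistent with the restriction to compact SIMPLE `G`; galaxy (`decimation|strong coupling regime|Tomboulis`, star all): no hit.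

HONEST FRAMING: an interface and two OPEN construction statements, typed; nothing here asserts that 4-d non-abelian lattice
Yang–Mills enters the class at any scale (that is complete-analyticity ∕ finite-correlation-length content at weak coupling — no
source); not a gap, not Clay.  No `sorry`; no instances, no notation.
Refs: FriedliVelenik2017 §5.2, §5.7.1; OsterwalderSeilerAnnPhys1978 §3; KoteckyPreiss1986; DobrushinShlosman1985/1987;
Balaban1987RG1 (blocking); arXiv:0707.2179, arXiv:0901.4246 (status of the decimation programme).
-/

set_option autoImplicit false

noncomputable section

open MeasureTheory
open Literature.MathematicalPhysics.QuantumFieldTheory Literature.MathematicalPhysics.QuantumLattice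
open Literature.Probability.LatticeModels (IsLocalPerturbation IsLocalObservable pertExpect)
open Summit.QuantumFields.YangMills.Cruxes.IR.Tempered (cellEdges windowCells regionEdges)

namespace Summit.QuantumFields.YangMills.Cruxes.IR.BlockedActivity

/-! ## §1 Cells and their adjacency -/

/-- A cell index of a frame (`ℤ⁴`). -/
abbrev Cell : Type := Fin 4 → ℤ

/-- Two cells are ADJACENT: sup-distance `≤ 1` (reflexive, symmetric; `3⁴ = 81` neighbours per cell). -/
abbrev CellAdj (c c' : Cell) : Prop := ∀ i : Fin 4, |c i - c' i| ≤ 1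

/-- The `81` cells adjacent to a cell. -/
def cellNbr (c : Cell) : Finset Cell := Fintype.piFinset fun i : Fin 4 => Finset.Icc (c i - 1) (c i + 1)

section Defs

variable {G : Type} [Group G] [TopologicalSpace G] [IsTopologicalGroup G] [CompactSpace G]
  [MeasurableSpace G] [BorelSpace G]

/-- A CENTRE OBSERVABLE of the frame `w`: a `[0,1]`-valued measurable cylinder function of the centre cell `0`
(the observables of `OnsetFormats.UnivShellCond`). -/
def IsCentreObs (w : Fin 4 → ℤ → ℤ) (f : LGConfig 4 G → ℝ) : Prop :=
  IsCylinder f (cellEdges w 0) ∧ Measurable f ∧ ∀ U, 0 ≤ f U ∧ f U ≤ 1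

/-- **Blocked local-perturbation representation** of the mesh-`b` YM kernel of the cell region `Y` of the frame `w`,
with activity radius `a` — the INPUT FORMAT of the tree's high-temperature ∕ Kotecký–Preiss layer
(`Literature.Probability.LatticeModels.IsLocalPerturbation`, `pertExpect`): a σ-INDEPENDENT reference probability space
`(Ω, μ)` («the blocked effective theory with the inter-cell couplings switched off») whose cell σ-algebras `𝓕 c`
are independent across non-touching cell sets (finite range), cell factors `g σ c` («the inter-cell couplings of the
blocked effective action under exterior datum `σ`», `𝓕 c`-measurable, `‖g σ c‖ ≤ a`), a realisation `obs f` of every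
centre observable as a cell-`0`-local observable of norm `≤ 1`, and the REPRESENTATION: the kernel expectation of `f`
under `ymSpecification ρ β (regionEdges w Y) σ` is the perturbed expectation `∫ obs f · ∏_{c ∈ C} (1 + g σ c) dμ ∕
∫ ∏_{c ∈ C} (1 + g σ c) dμ`.  The exterior datum enters ONLY through the cell factors, and only through the cells
adjacent to the factor's cell outside `Y` (`local_g`).  Data + axioms; nothing here asserts that such a representation
exists for any `(ρ, β, b)` — see `BlockedActivityOnsetSC`. -/
structure BlockedRep {N : ℕ} (ρ : G →* Matrix (Fin N) (Fin N) ℂ) (β : ℝ) (w : Fin 4 → ℤ → ℤ)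
    (Y : Finset Cell) (a : ℝ) : Type 1 where
  /-- the reference sample space -/
  Ω : Type
  /-- its σ-algebra -/
  mΩ : MeasurableSpace Ω
  /-- the reference (decoupled) probability measure -/
  μ : Measure Ω
  /-- it is a probability measure -/
  isProb : IsProbabilityMeasure μ
  /-- the local σ-algebras of the blocked cells -/
  𝓕 : Cell → MeasurableSpace Ω
  /-- the perturbed cells -/
  C : Finset Cell
  /-- the cell factors under an exterior datum -/
  g : LGConfig 4 G → Cell → Ω → ℂ
  /-- the realisation of centre observables on the reference space -/
  obs : (LGConfig 4 G → ℝ) → Ω → ℂ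
  /-- smallness and locality of the cell factors, finite-range dependence of the reference -/
  perturbation : ∀ σ, IsLocalPerturbation μ CellAdj 𝓕 (g σ) a
  /-- centre observables are realised as cell-`0`-local observables of norm `≤ 1` -/
  obs_local : ∀ f, IsCentreObs w f → IsLocalObservable 𝓕 (obs f) {0} 1
  /-- finite range of the exterior dependence: the factor of cell `p` reads the datum only on the cells adjacent to
  `p` outside `Y` -/
  local_g : ∀ p, ∀ σ σ' : LGConfig 4 G,
    (∀ c, CellAdj c p → c ∉ Y → ∀ e ∈ cellEdges w c, σ e = σ' e) → g σ p = g σ' p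
  /-- the representation of centre-cell kernel expectations as perturbed expectations -/
  rep : ∀ σ f, IsCentreObs w f →
    ((∫ U, f U ∂(ymSpecification ρ β (regionEdges w Y) σ) : ℝ) : ℂ) = pertExpect μ (g σ) (obs f) C

/-- **The blocked-activity class** at `(β, b, n)` with activity radius `a`: on every mesh-`b` frame the kernel of every
cell region `Y` of the `n`-window containing the centre cell admits a blocked local-perturbation representation of
activity radius `a` («the mesh-`b` blocked effective theory lies in the polymer-activity ball of radius `a`»: its
polymer activities `∫ ∏_{c ∈ K} g σ c dμ` are `≤ a^{#K}`, tree `norm_cellActivity_le`).  An INTERFACE (axioms only). -/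
def BlockedActivityClass {N : ℕ} (ρ : G →* Matrix (Fin N) (Fin N) ℂ) (β : ℝ) (b n : ℕ) (a : ℝ) : Prop :=
  ∀ w : Fin 4 → ℤ → ℤ, (∀ i j, w i j + ((b : ℕ) : ℤ) ≤ w i (j + 1) ∧ w i (j + 1) ≤ w i j + 2 * ((b : ℕ) : ℤ)) →
    ∀ Y : Finset Cell, Y ⊆ windowCells n → (0 : Cell) ∈ Y → Nonempty (BlockedRep ρ β w Y a)

/-- **Blocked-activity onset at `(G, ρ)`**: for every activity radius `a > 0`, at all large `β` SOME mesh `b ≥ 1` puts the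
theory in the blocked-activity class of radius `a` at window `1` («blocking to `b ≍ ξ_lat(β)` and beyond makes the effective
theory strongly coupled»).  Research content; not asserted. -/
def BlockedActivityOnsetAt {N : ℕ} (ρ : G →* Matrix (Fin N) (Fin N) ℂ) : Prop :=
  ∀ a : ℝ, 0 < a → ∃ β₂ : ℝ, ∀ β : ℝ, β₂ ≤ β → ∃ b : ℕ, 1 ≤ b ∧ BlockedActivityClass ρ β b 1 a

end Defs

/-- **The construction statement of lane B** (SIMPLY CONNECTED compact simple `G` only — the monopole wire of
`Theorems/IR/Negative/OnsetUcFalseOfMonopoleWire` kills every all-exterior onset statement on the `π₁ ≠ 1` family):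
every lattice representation of every simply connected compact simple `G` has a blocked-activity onset.
OPEN (complete-analyticity strength at one `β`-dependent scale); no source; not asserted anywhere in the tree. -/
def BlockedActivityOnsetSC : Prop :=
  ∀ (G : Type) [Group G] [TopologicalSpace G] [IsTopologicalGroup G] [CompactSpace G],
    IsCompactSimpleLieGroup G → SimplyConnectedSpace G →
    letI : MeasurableSpace G := borel G; haveI : BorelSpace G := ⟨rfl⟩;
    ∀ r : LatticeRep G, BlockedActivityOnsetAt r.ρ

end Summit.QuantumFields.YangMills.Cruxes.IR.BlockedActivity

end
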